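import Summits.QuantumFields.YangMills.Theorems.ThermalDescentTorusDictionary
import Summits.QuantumFields.YangMills.Theorems.ThermalDescentShortCentring
import Summits.QuantumFields.YangMills.Theorems.ThermalDescentOddTorusRP
import Literature.MathematicalPhysics.QuantumFieldTheory.SpeciesTimeReflection
import HarnessLib

/-!
# Route `SqueezedSkewness`, crux `AntipodalMirrorCeiling` (stmt-QuantumFields-23202), LINE «Markov ceiling» (planner ym-idea-6 g11):
# THE REFLECTED TORUS DICTIONARY — `Fin`-torus reflection covariances are `torusE` reflection covariances

The glue `AntipodalMarkovGlue` / `stub_markovGlueNarrow` of the «Markov ceiling» skeleton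
(`Cruxes/NT/Lines/antipodal_markov_birth.lean`) must read the route's antipodal mirror number
`N β T T h = Cov_T(Bc(ind h) ∘ refl, Bc(ind h))` — a `Fin`-torus covariance with the route's link reflection `refl`
(tree `ThermalDescentReflection.reflFT`) — as the left-hand side `Cov_T(dens z₀ ∘ Θ₀, dens z₀)` of the tree's Markov-mirror identity X2
(`Cruxes.NT.MarkovMirror.torusCov_reflect_lift_eq_torusCov_reflect_kerE`, `Θ₀ = cfgReflect` on the periodic lift).  The unreflected
dictionary is the tree's `ThermalDescentTorusDictionary` (`torusCov_eq_covF`: `zOf`, axis rotation `finRotate 4`, `psiZ_sitePerm`,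
`wilsonExpectation_configPerm`); this file adds the reflection:

* §1 `reflFT_equiv_configPerm` [folklore]: link by link, `reflFT ∘ (reindex ∘ rotate) = (reindex ∘ rotate) ∘ negReflect` — the route's
  reflection (time = `Fin` coordinate 3: spatial links to `(x⃗, −t)`, temporal links to `(x⃗, −t−1)` inverted) is the torus reflection
  `GaugeConfig.negReflect` (time = `ZMod` coordinate 0) conjugated by the reindexing `finTorusConfigEquivSite` and the axis rotation
  `configPerm (finRotate 4)⁻¹` (`ThermalDescentOddTorusRP.finEquiv_negT` / `finEquiv_rev`);
* §2 `eF_reflFT_mul_eq_torusE`, `eF_reflFT_eq_torusE`, `eF_eq_torusE`, ★ `covF_reflFT_eq_torusCov_reflect` [folklore]: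
  `Cov_P(aF u ∘ reflFT, aF u') = torusE-Cov(dens (zOf u) ∘ cfgReflect, dens (zOf u'))` on the odd torus `P = 2L+1`
  (`torusLift_negReflect`, `dens_torusLift_eq_psiZ`, `proj_zOf`, `psiZ_sitePerm`, `aF_equiv`, `eF_eq_wilsonExpectation`,
  `wilsonExpectation_configPerm`).

Width seat ym-line-sfw-p2-w5 g11 (cell ym-idea-1; free hands), `--supports stmt-QuantumFields-23202`.  THEOREMS ONLY, route-independent
(no `Theses` import).  HONEST FRAMING: finite-lattice bookkeeping; no crux, NT statement, rung or summit is proved; the Yang–Mills mass gap is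
NOT proved.
-/

set_option autoImplicit false

noncomputable section

namespace Summit.QuantumFields.YangMills.Theorems.SqueezedSkewnessAntipodalReflectedDictionary

open MeasureTheory Literature.MathematicalPhysics.QuantumFieldTheory Literature.MathematicalPhysics.QuantumLattice
open Literature.Probability.LatticeModels (Torus.proj Torus.proj_apply)
open Summit.QuantumFields.YangMills.Cruxes.OSLegsFromFemtoAndGap.DlrCollarTransfer (torusE dens)
open Summit.QuantumFields.YangMills.Theorems.ThermalDescentTorusDictionary
open Summit.QuantumFields.YangMills.Theorems.ThermalDescentReflection (negT reflFT)
open Summit.QuantumFields.YangMills.Theorems.ThermalDescentOddTorusRP (finEquiv_negT finEquiv_rev)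

variable {G : Type} [Group G] [MeasurableSpace G]

/-! ## §1 The route's link reflection `reflFT` is the torus reflection `negReflect`, read through the axis rotation -/

/-- **Link-level dictionary of the reflections**: reindexing (`finTorusConfigEquivSite`) the axis-rotated
(`configPerm (finRotate 4)⁻¹`, time `0 ↦ 3`) torus-reflected (`negReflect`, time = coordinate `0`) configuration gives the
route's reflection `reflFT` (time = coordinate `3`) of the reindexed axis-rotated configuration. [folklore] -/
theorem reflFT_equiv_configPerm {L : ℕ} (U : GaugeConfig 4 (2 * L + 1) G) :
    reflFT (finTorusConfigEquivSite G (2 * L + 1) (configPerm (finRotate 4).symm U)) =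
      finTorusConfigEquivSite G (2 * L + 1) (configPerm (finRotate 4).symm U.negReflect) := by
  funext ⟨⟨x1, x2, x3, t⟩, μ⟩
  simp only [reflFT, coe_finTorusConfigEquivSite, configPerm_apply, Equiv.symm_symm, GaugeConfig.negReflect]
  have hrot : ∀ ν : Fin 4, (finRotate 4 ν = 0 ↔ ν = Fin.last 3) := by decide
  by_cases hμ : μ = Fin.last 3
  · subst hμ
    have h0 : finRotate 4 (Fin.last 3) = 0 := by decide
    rw [if_pos rfl, if_pos h0]
    congr 2
    refine Prod.ext (funext fun k => ?_) h0
    dsimp only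
    by_cases hk : k = 0
    · subst hk
      rw [WilsonSiteRP.negReflect_apply_zero, Site.shift, Pi.add_apply, Pi.single_eq_same, sitePerm_apply,
        sitePerm_apply]
      simp [finTorusSiteEquivSite, finEquiv_rev]
      ring
    · rw [WilsonSiteRP.negReflect_apply_of_ne _ hk, Site.shift, Pi.add_apply, Pi.single_eq_of_ne hk, add_zero,
        sitePerm_apply, sitePerm_apply]
      have : (finRotate 4).symm k ≠ 3 := by
        intro h; apply hk; have := congrArg (finRotate 4) h; simpa using this
      fin_cases k
      · exact absurd rfl hk
      all_goals simp [finTorusSiteEquivSite]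
  · have hne : finRotate 4 μ ≠ 0 := fun h => hμ ((hrot μ).1 h)
    rw [if_neg hμ, if_neg hne]
    congr 1
    refine Prod.ext (funext fun k => ?_) rfl
    dsimp only
    by_cases hk : k = 0
    · subst hk
      rw [WilsonSiteRP.negReflect_apply_zero, sitePerm_apply, sitePerm_apply]
      simp [finTorusSiteEquivSite, finEquiv_negT]
    · rw [WilsonSiteRP.negReflect_apply_of_ne _ hk, sitePerm_apply, sitePerm_apply]
      fin_cases k
      · exact absurd rfl hk
      all_goals simp [finTorusSiteEquivSite]

/-! ## §2 Reflected one- and two-point dictionaries: `Fin`-torus expectations with `reflFT` are `torusE`s with `cfgReflect` -/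

section Expectations

variable [TopologicalSpace G] [IsTopologicalGroup G] [CompactSpace G] [BorelSpace G] (r : LatticeRep G)

/-- **Reflected two-point dictionary**: `E_P[(aF u ∘ reflFT) · aF u'] = torusE[(dens (zOf u) ∘ Θ₀) · dens (zOf u')]` on the odd
torus `P = 2L+1` (`Θ₀ = cfgReflect`). [folklore] -/
theorem eF_reflFT_mul_eq_torusE (β : ℝ) (L : ℕ)
    (u u' : FinTorusSite (2 * L + 1) (2 * L + 1) (2 * L + 1) (2 * L + 1)) :
    eF r β (2 * L + 1) (fun V => aF r u (reflFT V) * aF r u' V) =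
      torusE G r β L (fun U => dens G r (zOf (2 * L + 1) u) (cfgReflect U) * dens G r (zOf (2 * L + 1) u') U) := by
  rw [torusE_eq_wilsonExpectation, eF_eq_wilsonExpectation,
    ← wilsonExpectation_configPerm r β (2 * L + 1) (finRotate 4).symm
      (fun U => aF r u (reflFT (finTorusConfigEquivSite G (2 * L + 1) U)) * aF r u' (finTorusConfigEquivSite G (2 * L + 1) U))]
  refine congrArg _ (funext fun U => ?_)
  simp only [reflFT_equiv_configPerm, aF_equiv, ← torusLift_negReflect, dens_torusLift_eq_psiZ, proj_zOf, psiZ_sitePerm]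

/-- **Reflected one-point dictionary**: `E_P[aF u ∘ reflFT] = torusE[dens (zOf u) ∘ Θ₀]`. [folklore] -/
theorem eF_reflFT_eq_torusE (β : ℝ) (L : ℕ) (u : FinTorusSite (2 * L + 1) (2 * L + 1) (2 * L + 1) (2 * L + 1)) :
    eF r β (2 * L + 1) (fun V => aF r u (reflFT V)) =
      torusE G r β L (fun U => dens G r (zOf (2 * L + 1) u) (cfgReflect U)) := by
  rw [torusE_eq_wilsonExpectation, eF_eq_wilsonExpectation,
    ← wilsonExpectation_configPerm r β (2 * L + 1) (finRotate 4).symm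
      (fun U => aF r u (reflFT (finTorusConfigEquivSite G (2 * L + 1) U)))]
  refine congrArg _ (funext fun U => ?_)
  simp only [reflFT_equiv_configPerm, aF_equiv, ← torusLift_negReflect, dens_torusLift_eq_psiZ, proj_zOf, psiZ_sitePerm]

/-- **One-point dictionary** (unreflected): `E_P[aF u] = torusE[dens (zOf u)]`. [folklore] -/
theorem eF_eq_torusE (β : ℝ) (L : ℕ) (u : FinTorusSite (2 * L + 1) (2 * L + 1) (2 * L + 1) (2 * L + 1)) :
    eF r β (2 * L + 1) (aF r u) = torusE G r β L (dens G r (zOf (2 * L + 1) u)) := by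
  rw [torusE_eq_wilsonExpectation, eF_eq_wilsonExpectation,
    ← wilsonExpectation_configPerm r β (2 * L + 1) (finRotate 4).symm
      (fun U => aF r u (finTorusConfigEquivSite G (2 * L + 1) U))]
  refine congrArg _ (funext fun U => ?_)
  simp only [aF_equiv, dens_torusLift_eq_psiZ, proj_zOf, psiZ_sitePerm]

/-- **THE REFLECTED COVARIANCE DICTIONARY**: the `Fin`-torus reflection covariance of the plaquette sums at `u, u'` is the
`torusE` reflection covariance of the action densities at `zOf u, zOf u'` (the left-hand side of the Markov-mirror identity X2).
[folklore] -/
theorem covF_reflFT_eq_torusCov_reflect (β : ℝ) (L : ℕ)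
    (u u' : FinTorusSite (2 * L + 1) (2 * L + 1) (2 * L + 1) (2 * L + 1)) :
    eF r β (2 * L + 1) (fun V => aF r u (reflFT V) * aF r u' V) -
        eF r β (2 * L + 1) (fun V => aF r u (reflFT V)) * eF r β (2 * L + 1) (aF r u') =
      torusE G r β L (fun U => dens G r (zOf (2 * L + 1) u) (cfgReflect U) * dens G r (zOf (2 * L + 1) u') U) -
        torusE G r β L (fun U => dens G r (zOf (2 * L + 1) u) (cfgReflect U)) *
          torusE G r β L (dens G r (zOf (2 * L + 1) u')) := by
  rw [eF_reflFT_mul_eq_torusE, eF_reflFT_eq_torusE, eF_eq_torusE]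

end Expectations

end Summit.QuantumFields.YangMills.Theorems.SqueezedSkewnessAntipodalReflectedDictionary
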